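import Summits.BirchSwinnertonDyer.BirchSwinnertonDyer.Theorems.Rank1ResidualJetCarrierMult
import Summits.BirchSwinnertonDyer.BirchSwinnertonDyer.Theorems.Rank1ResidualJetCarrierNe
import Summits.BirchSwinnertonDyer.Rank1Residual.X11b.ShaAnBinderFromIndexRecordJetchev
import HarnessLib

/-!
# X11b (multiplicative `p`, rank one), the Tamagawa atom (T2′) `p ∣ #Ш_an` rows: the two-sided
# certificate road (exact `p`-descent `#Sel^(p)(E/ℚ) = p^(1+2k)` + Tamagawa-inflated Heegner index
# `ord_p [E(K):ℤP] ≤ k + ord_p c_q`) through the `bsd-jet` READING binders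
# `JET.JetchevDivisibilityCarrierMult` (`q = p`) / `JET.JetchevDivisibilityCarrierNe` (`q ≠ p`)
# INSTEAD OF the flagged Miller 2011 Thm. 5.4 (Cha case) — cell `b2b-bsdres`, unit `x11b` gen 31;
# the (J∥)-currency twin of `ShaAnBinderFromIndexRecordJetchev.lean` (gen 21)

HONEST FRAMING (cell `b2b-bsdres`, run/shared/lean/b2b/bsd-rank1-residual/, verbatim in every
file): the goal of the cell is to DELETE the COMBINATION-SHAPED residual classes of the
Birch–Swinnerton-Dyer formula for ALL analytic-rank `≤ 1` elliptic curves over `ℚ` — "full BSD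
formula for every rank `≤ 1` curve in class `C`" assembled STRICTLY from published theorems — so
that the rank-`≤ 1` remainder becomes exactly the CONSTRUCTION-SHAPED classes, which are TYPED
(missing-input `Prop`s), NOT attempted. This is not "finishing BSD". X11b (multiplicative `p`,
`r = 1`) and X11 ∧ `r = 1` ∧ `p = 3` stay CONSTRUCTION-SHAPED (referee A R6.2). Per pair; research
route; nothing is booked by this file (the lane certifies, the referee books); no mark / label /
count moves. THEOREMS ONLY (no definition, no named fact, no `sorry`); tree theorems are composed,
nothing is re-proved. Every declaration takes the `bsd-jet` cell's READING binder
`JET.JetchevDivisibilityCarrierMult` or `JET.JetchevDivisibilityCarrierNe`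
(`Theorems/Rank1ResidualJetDefs.lean`: Jetchev 2008 Thm. 1.4 `m_∞ ≥ ord_p c_q` read at a
MULTIPLICATIVE `p ∥ N` — NOT a published statement; the programme's crux «(J∥) = K1 ∧ K3») as an
explicit hypothesis `hJ`: every result is CONDITIONAL on it and on the published named facts listed.

WHAT THE FILE DOES. Of the lane's 20 798 X11b@3 rank-one residue classes (`N < 5·10⁵`) exactly FIVE —
the (T2′) LB3 rows `191424ce1`, `318828a1`, `368358k1`, `463488bg1`, `498525ca1` (`#Sel₃ = 27` EXACT,
`#Ш_an = 9`, `ord₃ [E(K):ℤP] = 2`, ONE prime `q` with `3 ∣ c_q`; `ρ̄_{E,3}` onto; `D = −23, −23, −23,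
−47, −191`; record `4 = 2 + 1 + 1`) — have a kernel consumer only through the TWO-FLAG road
(`Miller2011.thm54_cha_…`: `Miller11-Thm54-Cha-case` + `JET@3|N`; `X11b/Three/TamagawaAtomSelmerCertificate.lean`,
`ShaAnBinderFromIndexRecordJetchev.lean`). Team x11b3's flag-free receptacle
`X11b.Three.bsdp_of_jetchevShapeAt_of_card_selmer` takes the Tamagawa-sharpened bound AT THE DATUM
`ord_p #Ш(E/ℚ) + 2·ord_p c_q(E) ≤ 2·ord_p [E(K):ℤP]` as `hJ`; the `bsd-jet` consumers now PROVE that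
bound from their reading binders and published facts (`JET.shaOrder_add_tamagawa_le_index_of_carrierMult`,
`JET.sha_card_add_tamagawa_le_index_of_carrierNe`), while their certificate theorems stop at
`p ∤ #Ш_an`. This file supplies the `p ∣ #Ш_an` case (`k ≥ 1`): §1 class-free at any odd
MULTIPLICATIVE `p` (tower DISCHARGED from `ρ̄_{E,p}` onto by `forall_hasSurjectiveModNGaloisRep_pow_of_multiplicative_of_surj`);
§2 the `p = 3` rows' exact shape (`IsX11Three`), carrier `q = 3` (B-like: `191424ce1` split `I₆`,
`463488bg1` split `I₃`) resp. `q ≠ 3` (A-like: `318828a1` `q = 2` `IV`, `368358k1` `q = 29` `IV*`,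
`498525ca1` `q = 17` `IV*`); §3 the same `hs`-free, `hs : shaAn W = s` REPLACED by the exact
Gross–Zagier index record (`exists_shaAn_padicValRat_eq_of_indexRecord`, gen 21), Cha-free. NOT DONE
HERE: proving (J∥) or any instance; lifting or pricing a flag; certifying a record; booking; labels.
EVIDENCE pointers only (`HOME/b2b-bsdres-x11b/g21/`, `g30/DOSSIER-JET3-X11B-RESIDUE-FIVE.md`).
References: [Jetchev2008] Thm. 1.4, Cor. 1.5; [McCallumLMS1991] §5; [GrossLMS1991] Prop. 6.2 (1);
[Darmon2004] Thm. 3.6; [Miller2011LMS] Def. 1.1, Thm. 5.4; [Wuthrich2014] Lemma 20;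
[JetchevSkinnerWan2017] §7.4.1; `Theorems/Rank1ResidualJet{Defs,CarrierMult,CarrierNe}.lean` (`bsd-jet`).
-/

noncomputable section

open scoped Classical

open WeierstrassCurve NumberField Literature.NumberTheory.EllipticCurves
  Literature.NumberTheory.EllipticCurves.ModularForms
  Literature.NumberTheory.EllipticCurves.Rank1Residual
  Literature.NumberTheory.EllipticCurves.Rank1Residual.Typed
  Literature.NumberTheory.QuadraticFields

namespace Summit.BirchSwinnertonDyer.Rank1Residual.X11b

/-! ### §1. Class-free, any odd multiplicative `p`: the two-sided certificate through the reading binders -/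

section ClassFree

variable (W : WeierstrassCurve ℚ) [W.IsElliptic] [W.IsGloballyMinimal] [NeZero (W.conductorNorm ℤ)]
  (p : ℕ) [Fact p.Prime] (K : Type) [Field K] [NumberField K]

/-- **The over-`ℚ` shape at a carrier `q ≠ p`**: `ord_p #Ш(E/ℚ) + 2·ord_p c_q(E) ≤ 2·ord_p [E(K):ℤP]`
— exactly the binder `hJ` of `X11b.Three.bsdp_of_jetchevShapeAt_of_card_selmer` — from the `bsd-jet`
bound over `K` (`JET.sha_card_add_tamagawa_le_index_of_carrierNe`) and `ord_p #Ш(E/ℚ) ≤ ord_p #Ш(E/K)`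
for odd `p` (`padicValNat_shaOrder_le_baseChange_of_odd`; `Ш(E/K)` finite by Kolyvagin). Data: `W/ℚ`
globally minimal, `K` imaginary quadratic Heegner for `N = W.conductorNorm ℤ`, `d_K ∉ {−3,−4}`, `p` odd
with the `p`-adic tower onto, `P` a Heegner point of infinite order, `q ∣ N`, `q ≠ p`. CONDITIONAL on
the READING binder `hJ : JET.JetchevDivisibilityCarrierNe` and the published `hMcU`, `hKo`, `hShi`,
`hD36`. Per pair; nothing booked. [cite: Jetchev2008, Cor. 1.5 (p. 812)]
[cite: McCallumLMS1991, §5 Cor. 5.6 (p. 310)] [cite: SerreGaloisCohomology1997, I.§2.4 Cor. to Prop. 9] -/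
theorem shaOrder_add_tamagawa_le_index_of_carrierNe
    (hJ : JET.JetchevDivisibilityCarrierNe)
    (hMcU : McCallum1991_padicValNat_card_sha_primary_add_le_of_globalDivisibility)
    (hKo : kolyvagin (W.conductorNorm ℤ) W K)
    (hShi : heegnerPointOfConductor_one_galoisConj (W.conductorNorm ℤ) W K)
    (hD36 : phi_heegnerTau_mem_singularModuliField (W.conductorNorm ℤ) W K)
    (hK : IsImaginaryQuadratic K) (hD3 : NumberField.discr K ≠ -3) (hD4 : NumberField.discr K ≠ -4)
    (hH : SatisfiesHeegnerHypothesis (W.conductorNorm ℤ) K)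
    (hp2 : p ≠ 2) (htower : ∀ n : ℕ, W.HasSurjectiveModNGaloisRep (p ^ n : ℕ))
    {P : (W.baseChange K).toAffine.Point} (hP : IsHeegnerPoint (W.conductorNorm ℤ) W K P)
    (hnt : ¬ IsOfFinAddOrder P)
    (q : ℕ) [Fact q.Prime] (hq : q ∣ W.conductorNorm ℤ) (hqp : q ≠ p) :
    padicValNat p W.shaOrder + 2 * padicValNat p ((W.baseChange ℚ_[q]).localTamagawaNumber ℤ_[q]) ≤
      2 * padicValNat p (AddSubgroup.zmultiples P).index := by
  obtain ⟨-, hfinK⟩ := hKo hK hH hP hnt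
  have hK' := JET.sha_card_add_tamagawa_le_index_of_carrierNe hJ hMcU W K hKo hShi hD36 hK hD3 hD4 hH p
    hp2 htower hP hnt q hq hqp
  have hQK := padicValNat_shaOrder_le_baseChange_of_odd W K hK p hp2 (shaFinite_of_baseChange W K hfinK)
    hfinK
  omega

/-- **Rank one, odd MULTIPLICATIVE `p`, carrier `q = p` (bucket B): `BSD(E,p)` from the two-sided
certificate through the reading binder `JET.JetchevDivisibilityCarrierMult`.** Binders: `hJ` (READING,
not published), `hMcU` (McCallum Cor. 5.6), `hKo` (Kolyvagin), `hShi` (Shimura reciprocity at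
conductor `1`), `hD36` (Darmon Thm. 3.6), `hGZK` — published. Per pair: `W/ℚ` globally minimal,
`r_an = 1`; `p ≠ 2` multiplicative with `ρ̄_{E,p}` onto (tower by
`forall_hasSurjectiveModNGaloisRep_pow_of_multiplicative_of_surj`, `E[p]` irreducible follows); `K`
Heegner for `N = W.conductorNorm ℤ`, `d_K ∉ {−3,−4}`; a Heegner point `P` of infinite order; the
INFLATED index certificate `ord_p [E(K):ℤP] ≤ k + ord_p c_p(E)`; `#Sel^(p)(E/ℚ) = p^(1+2k)`;
`ord_p #Ш_an = 2k`. Proof: `JET.shaOrder_add_tamagawa_le_index_of_carrierMult` is the `hJ` of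
`X11b.Three.bsdp_of_jetchevShapeAt_of_card_selmer`. CONDITIONAL on `hJ` and the facts; NOT a class
theorem; nothing booked. [cite: Jetchev2008, Thm. 1.4 and Cor. 1.5 (p. 812)]
[cite: McCallumLMS1991, §5 Cor. 5.6 (p. 310)] [cite: Miller2011LMS, Thm. 5.4 and Def. 1.1]
[cite: Wuthrich2014, Lemma 20 (p. 399)] [cite: SilvermanAEC2009, Thm. X.4.2(a)] -/
theorem bsdp_of_carrierMult_of_card_selmer
    (hJ : JET.JetchevDivisibilityCarrierMult)
    (hMcU : McCallum1991_padicValNat_card_sha_primary_add_le_of_globalDivisibility)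
    (hGZK : rank_eq_analyticRank_of_analyticRank_le_one)
    (hKo : kolyvagin (W.conductorNorm ℤ) W K)
    (hShi : heegnerPointOfConductor_one_galoisConj (W.conductorNorm ℤ) W K)
    (hD36 : phi_heegnerTau_mem_singularModuliField (W.conductorNorm ℤ) W K)
    (hK : IsImaginaryQuadratic K) (hD3 : NumberField.discr K ≠ -3) (hD4 : NumberField.discr K ≠ -4)
    (hH : SatisfiesHeegnerHypothesis (W.conductorNorm ℤ) K)
    (hp2 : p ≠ 2) (hmult : Mult W p) (hsurj : W.HasSurjectiveModNGaloisRep p)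
    {P : (W.baseChange K).toAffine.Point} (hP : IsHeegnerPoint (W.conductorNorm ℤ) W K P)
    (hnt : ¬ IsOfFinAddOrder P) (hr : W.analyticRank = 1) {k : ℕ}
    (hI : padicValNat p (AddSubgroup.zmultiples P).index ≤
      k + padicValNat p ((W.baseChange ℚ_[p]).localTamagawaNumber ℤ_[p]))
    (hcard : Nat.card (W.selmerGroup (p : ℤ)) = p ^ (1 + 2 * k))
    {s : ℚ} (hs : shaAn W = (s : ℂ)) (hv : padicValRat p s = 2 * k) : BSDp W p := by
  have htower : ∀ n : ℕ, W.HasSurjectiveModNGaloisRep (p ^ n : ℕ) := fun n ↦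
    W.forall_hasSurjectiveModNGaloisRep_pow_of_multiplicative_of_surj p hp2 hmult hsurj n
  haveI : NeZero (p : ℚ) := ⟨Nat.cast_ne_zero.mpr (Fact.out : p.Prime).ne_zero⟩
  have hirr : Irr W p := hasIrreducibleModPGaloisRep_of_hasSurjectiveModNGaloisRep W p hsurj
  exact Three.bsdp_of_jetchevShapeAt_of_card_selmer W p hGZK hr hirr P p (k := k)
    (JET.shaOrder_add_tamagawa_le_index_of_carrierMult hJ hMcU W K hKo hShi hD36 hK hD3 hD4 hH p hp2
      hmult htower hP hnt) hI hcard hs hv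

/-- **Rank one, odd MULTIPLICATIVE `p`, carrier `q ≠ p` (bucket A: `q ∣ N`, any reduction at `q`):
`BSD(E,p)` through the reading binder `JET.JetchevDivisibilityCarrierNe`** — as
`bsdp_of_carrierMult_of_card_selmer` with the inflated index certificate
`ord_p [E(K):ℤP] ≤ k + ord_p c_q(E)` at ONE `q ∣ N`, `q ≠ p` (multiplicativity of `p` only
discharges the tower). CONDITIONAL on `hJ` (READING) and the published `hMcU`, `hKo`, `hShi`, `hD36`,
`hGZK`; NOT a class theorem; nothing booked. [cite: Jetchev2008, Thm. 1.4 and Cor. 1.5 (p. 812)]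
[cite: McCallumLMS1991, §5 Cor. 5.6 (p. 310)] [cite: Miller2011LMS, Thm. 5.4 and Def. 1.1]
[cite: Wuthrich2014, Lemma 20 (p. 399)] [cite: SilvermanAEC2009, Thm. X.4.2(a)] -/
theorem bsdp_of_carrierNe_of_card_selmer
    (hJ : JET.JetchevDivisibilityCarrierNe)
    (hMcU : McCallum1991_padicValNat_card_sha_primary_add_le_of_globalDivisibility)
    (hGZK : rank_eq_analyticRank_of_analyticRank_le_one)
    (hKo : kolyvagin (W.conductorNorm ℤ) W K)
    (hShi : heegnerPointOfConductor_one_galoisConj (W.conductorNorm ℤ) W K)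
    (hD36 : phi_heegnerTau_mem_singularModuliField (W.conductorNorm ℤ) W K)
    (hK : IsImaginaryQuadratic K) (hD3 : NumberField.discr K ≠ -3) (hD4 : NumberField.discr K ≠ -4)
    (hH : SatisfiesHeegnerHypothesis (W.conductorNorm ℤ) K)
    (hp2 : p ≠ 2) (hmult : Mult W p) (hsurj : W.HasSurjectiveModNGaloisRep p)
    {P : (W.baseChange K).toAffine.Point} (hP : IsHeegnerPoint (W.conductorNorm ℤ) W K P)
    (hnt : ¬ IsOfFinAddOrder P) (hr : W.analyticRank = 1)
    (q : ℕ) [Fact q.Prime] (hq : q ∣ W.conductorNorm ℤ) (hqp : q ≠ p) {k : ℕ}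
    (hI : padicValNat p (AddSubgroup.zmultiples P).index ≤
      k + padicValNat p ((W.baseChange ℚ_[q]).localTamagawaNumber ℤ_[q]))
    (hcard : Nat.card (W.selmerGroup (p : ℤ)) = p ^ (1 + 2 * k))
    {s : ℚ} (hs : shaAn W = (s : ℂ)) (hv : padicValRat p s = 2 * k) : BSDp W p := by
  have htower : ∀ n : ℕ, W.HasSurjectiveModNGaloisRep (p ^ n : ℕ) := fun n ↦
    W.forall_hasSurjectiveModNGaloisRep_pow_of_multiplicative_of_surj p hp2 hmult hsurj n
  haveI : NeZero (p : ℚ) := ⟨Nat.cast_ne_zero.mpr (Fact.out : p.Prime).ne_zero⟩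
  have hirr : Irr W p := hasIrreducibleModPGaloisRep_of_hasSurjectiveModNGaloisRep W p hsurj
  exact Three.bsdp_of_jetchevShapeAt_of_card_selmer W p hGZK hr hirr P q (k := k)
    (shaOrder_add_tamagawa_le_index_of_carrierNe W p K hJ hMcU hKo hShi hD36 hK hD3 hD4 hH hp2 htower hP
      hnt q hq hqp) hI hcard hs hv

end ClassFree

/-! ### §2. The `p = 3` rows (`IsX11Three`): the (T2′) LB3 shape `#Sel₃ = 27`, `ord₃ #Ш_an = 2` -/

section Three

variable (W : WeierstrassCurve ℚ) [W.IsElliptic] [W.IsGloballyMinimal] [NeZero (W.conductorNorm ℤ)]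
  (K : Type) [Field K] [NumberField K]

/-- **The (T2′) LB3 rows at `p = 3`, carrier `q = 3` (B-like: `3 ∣ c_3(E)`), through
`JET.JetchevDivisibilityCarrierMult`**: `IsX11Three W` with `ρ̄_{E,3}` onto, a Heegner field of record
`K` for `N_E` with `d_K < −4`, `P = y_K` of infinite order, `ord₃ [E(K):ℤP] ≤ 2`, `1 ≤ ord₃ c_3(E)`,
EXACT `#Sel^(3)(E/ℚ) = 27`, `ord₃ #Ш(E)_an = 2` ⇒ `BSD(E,3)` — the (J∥)-currency twin of
`IsX11Three.bsdp_of_millerJetchev_of_card_selmerThree_eq` (x11b3-p5; there FLAGS `Miller11-Thm54-Cha-case`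
+ `JET@3|N`). EVIDENCE pointer (nothing asserted): rows `191424ce1` (split `I₆`, `D = −23`),
`463488bg1` (split `I₃`, `D = −47`). CONDITIONAL on `hJ` and the published binders; per pair; nothing
booked; label unchanged. [cite: Jetchev2008, Thm. 1.4 and Cor. 1.5 (p. 812)]
[cite: Miller2011LMS, Def. 1.1] [cite: Wuthrich2014, Lemma 20 (p. 399)] -/
theorem IsX11Three.bsdp_of_carrierMult_of_card_selmerThree_eq
    (hJ : JET.JetchevDivisibilityCarrierMult)
    (hMcU : McCallum1991_padicValNat_card_sha_primary_add_le_of_globalDivisibility)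
    (hGZK : rank_eq_analyticRank_of_analyticRank_le_one)
    (hKo : kolyvagin (W.conductorNorm ℤ) W K)
    (hShi : heegnerPointOfConductor_one_galoisConj (W.conductorNorm ℤ) W K)
    (hD36 : phi_heegnerTau_mem_singularModuliField (W.conductorNorm ℤ) W K)
    (hX : IsX11Three W) (hsurj : W.HasSurjectiveModNGaloisRep 3)
    (hK : IsImaginaryQuadratic K) (hdK : NumberField.discr K < -4)
    (hH : SatisfiesHeegnerHypothesis (W.conductorNorm ℤ) K)
    {P : (W.baseChange K).toAffine.Point} (hP : IsHeegnerPoint (W.conductorNorm ℤ) W K P)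
    (hnt : ¬ IsOfFinAddOrder P)
    (hcq : 1 ≤ padicValNat 3 ((W.baseChange ℚ_[3]).localTamagawaNumber ℤ_[3]))
    (hI : padicValNat 3 (AddSubgroup.zmultiples P).index ≤ 2) (hcard : Nat.card (W.selmerGroup (3 : ℤ)) = 27)
    {s : ℚ} (hs : shaAn W = (s : ℂ)) (hv : padicValRat 3 s = 2) : BSDp W 3 :=
  haveI : Fact (Nat.Prime 3) := ⟨by norm_num⟩
  bsdp_of_carrierMult_of_card_selmer W 3 K hJ hMcU hGZK hKo hShi hD36 hK (by omega) (by omega) hH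
    (by norm_num) hX.mult hsurj hP hnt hX.rank (k := 1) (by omega)
    (by rw [show ((3 : ℕ) : ℤ) = 3 by norm_num, hcard]; norm_num) hs (by rw [hv]; norm_num)

/-- **The (T2′) LB3 rows at `p = 3`, carrier `q ≠ 3` (A-like: `3 ∣ c_q(E)`, `q ∣ N_E` additive or
multiplicative), through `JET.JetchevDivisibilityCarrierNe`** — as the `CarrierMult` twin with
`1 ≤ ord₃ c_q(E)`, `q ≠ 3`. EVIDENCE pointer (nothing asserted): rows `318828a1` (`q = 2`, `IV`,
`D = −23`), `368358k1` (`q = 29`, `IV*`, `D = −23`), `498525ca1` (`q = 17`, `IV*`, `D = −191`).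
CONDITIONAL on `hJ` and the published binders; per pair; nothing booked; label unchanged.
[cite: Jetchev2008, Thm. 1.4 and Cor. 1.5 (p. 812)] [cite: Miller2011LMS, Def. 1.1]
[cite: Wuthrich2014, Lemma 20 (p. 399)] -/
theorem IsX11Three.bsdp_of_carrierNe_of_card_selmerThree_eq
    (hJ : JET.JetchevDivisibilityCarrierNe)
    (hMcU : McCallum1991_padicValNat_card_sha_primary_add_le_of_globalDivisibility)
    (hGZK : rank_eq_analyticRank_of_analyticRank_le_one)
    (hKo : kolyvagin (W.conductorNorm ℤ) W K)
    (hShi : heegnerPointOfConductor_one_galoisConj (W.conductorNorm ℤ) W K)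
    (hD36 : phi_heegnerTau_mem_singularModuliField (W.conductorNorm ℤ) W K)
    (hX : IsX11Three W) (hsurj : W.HasSurjectiveModNGaloisRep 3)
    (hK : IsImaginaryQuadratic K) (hdK : NumberField.discr K < -4)
    (hH : SatisfiesHeegnerHypothesis (W.conductorNorm ℤ) K)
    {P : (W.baseChange K).toAffine.Point} (hP : IsHeegnerPoint (W.conductorNorm ℤ) W K P)
    (hnt : ¬ IsOfFinAddOrder P)
    (q : ℕ) [Fact q.Prime] (hq : q ∣ W.conductorNorm ℤ) (hq3 : q ≠ 3)
    (hcq : 1 ≤ padicValNat 3 ((W.baseChange ℚ_[q]).localTamagawaNumber ℤ_[q]))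
    (hI : padicValNat 3 (AddSubgroup.zmultiples P).index ≤ 2) (hcard : Nat.card (W.selmerGroup (3 : ℤ)) = 27)
    {s : ℚ} (hs : shaAn W = (s : ℂ)) (hv : padicValRat 3 s = 2) : BSDp W 3 :=
  haveI : Fact (Nat.Prime 3) := ⟨by norm_num⟩
  bsdp_of_carrierNe_of_card_selmer W 3 K hJ hMcU hGZK hKo hShi hD36 hK (by omega) (by omega) hH
    (by norm_num) hX.mult hsurj hP hnt hX.rank q hq hq3 (k := 1) (by omega)
    (by rw [show ((3 : ℕ) : ℤ) = 3 by norm_num, hcard]; norm_num) hs (by rw [hv]; norm_num)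

end Three

/-! ### §3. `hs`-free: the `#Ш_an` binder replaced by the exact Gross–Zagier index record (as gen 21) -/

section Record

variable (W : WeierstrassCurve ℚ) [W.IsElliptic] [W.IsGloballyMinimal] (p : ℕ) [Fact p.Prime]
  [NeZero (W.conductorNorm ℤ)] (K : Type) [Field K] [NumberField K]
  (Dt : ModularParametrizationData W (W.conductorNorm ℤ))
  (H : HeegnerDatum (W.conductorNorm ℤ) (NumberField.discr K)) (ι : K →+* ℂ)
  (P : (W.baseChange K).toAffine.Point)

/-- **X11b (`ClassX11b W p`: `r_an = 1 ∧ p ≠ 2 ∧ mult(p) ∧ irr(p)`) with `ρ̄_{E,p}` onto, carrier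
`q = p`, `hs`-FREE**: `BSD(E,p)` from the reading binder `JET.JetchevDivisibilityCarrierMult`, the
PUBLISHED `hGZ`, `hKo`, `hGZK`, `hmod`, `hMcU`, `hShi`, `hD36`, the inflated index certificate
`ord_p [E(K):ℤP] ≤ k + ord_p c_p(E)`, the exact index record at a Heegner field with `d_K < −4`,
`2·ord_p [E(K):ℤP] = 2k + ord_p q_d + ord_p ∏_ℓ c_ℓ(E)`, and ONE exact `p`-descent
`#Sel^(p)(E/ℚ) = p^(1+2k)` — NO `#Ш_an` binder, NO Miller–Cha fact. `P` is the Heegner point of the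
conductor-level datum `(Dt, H, ι)` (non-torsion by `not_isOfFinAddOrder_heegner_of_rankOne_of_twist`);
`(hs, hv)` from `exists_shaAn_padicValRat_eq_of_indexRecord` with `p ∤ w_K` and `ord_p u(Cd) = 0`
DISCHARGED (`X2.not_dvd_unitsTorsionOrder_of_discr_lt`, `padicValRat_u_eq_zero_of_twist_minimal`); the
Manin binder `p ∤ c(Dt)` stays displayed. CONDITIONAL on `hJ` and the facts; per pair; NOT a class
theorem; nothing booked. [cite: Jetchev2008, Thm. 1.4 and Cor. 1.5 (p. 812)]
[cite: JetchevSkinnerWan2017, §7.4.1 (eq:gz for K′), pp. 29–30] [cite: McCallumLMS1991, §5 Cor. 5.6 (p. 310)]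
[cite: Miller2011LMS, Def. 1.1] [cite: SilvermanAEC2009, VII.1 Prop. 1.3(b) and Thm. X.4.2(a)] -/
theorem ClassX11b.bsdp_of_carrierMult_of_card_selmer_of_indexRecord
    (hJ : JET.JetchevDivisibilityCarrierMult)
    (hMcU : McCallum1991_padicValNat_card_sha_primary_add_le_of_globalDivisibility)
    (hGZ : gross_zagier (W.conductorNorm ℤ) W K) (hKo : kolyvagin (W.conductorNorm ℤ) W K)
    (hGZK : rank_eq_analyticRank_of_analyticRank_le_one) (hmod : hasEntireLFunction_rat)
    (hShi : heegnerPointOfConductor_one_galoisConj (W.conductorNorm ℤ) W K)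
    (hD36 : phi_heegnerTau_mem_singularModuliField (W.conductorNorm ℤ) W K)
    (hX : ClassX11b W p) (hsurj : W.HasSurjectiveModNGaloisRep p)
    (hK : IsImaginaryQuadratic K) (hdK : NumberField.discr K < -4)
    (hHN : SatisfiesHeegnerHypothesis (W.conductorNorm ℤ) K)
    (hP : (P.map ι.toRatAlgHom) = heegnerPointComplex Dt H) (hc : ¬ (p : ℤ) ∣ Dt.c)
    (Wd : WeierstrassCurve ℚ) [Wd.IsElliptic] [Wd.IsGloballyMinimal] (Cd : VariableChange ℚ)
    (hWd : Cd • W.quadraticTwist (NumberField.discr K : ℚ) = Wd)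
    (qd : ℚ) (hqd : Wd.entireLFunction 1 / (Wd.realPeriodRat : ℂ) = (qd : ℂ)) (hqd0 : qd ≠ 0) {k : ℕ}
    (hI : padicValNat p (AddSubgroup.zmultiples P).index ≤
      k + padicValNat p ((W.baseChange ℚ_[p]).localTamagawaNumber ℤ_[p]))
    (hrec : 2 * (padicValNat p (AddSubgroup.zmultiples P).index : ℤ) =
      (2 * k : ℕ) + padicValRat p qd + padicValNat p W.tamagawaProduct)
    (hcard : Nat.card (W.selmerGroup (p : ℤ)) = p ^ (1 + 2 * k)) : BSDp W p := by
  obtain ⟨hr, hp2, hmult, hirr⟩ := hX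
  have hμ : ¬ p ∣ Units.torsionOrder K := X2.not_dvd_unitsTorsionOrder_of_discr_lt hK hdK Fact.out hp2
  have hu : padicValRat p (Cd.u : ℚ) = 0 :=
    padicValRat_u_eq_zero_of_twist_minimal W p K hK hHN hmult Cd hWd
  obtain ⟨s, hs, hv⟩ := exists_shaAn_padicValRat_eq_of_indexRecord W p (W.conductorNorm ℤ) K Dt H ι P
    hGZ hKo hGZK hmod hK hHN hP hp2 hc hμ hr hirr Wd Cd hWd hu qd hqd hqd0 (j := 2 * k) hrec
  have hnt : ¬ IsOfFinAddOrder P :=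
    not_isOfFinAddOrder_heegner_of_rankOne_of_twist W (W.conductorNorm ℤ) K Dt H ι P hGZ hmod hK hHN hP
      hr Wd Cd hWd qd hqd hqd0
  exact bsdp_of_carrierMult_of_card_selmer W p K hJ hMcU hGZK hKo hShi hD36 hK (by omega) (by omega) hHN
    hp2 hmult hsurj ⟨Dt, H, ι, hP⟩ hnt hr (k := k) hI hcard hs (by rw [hv]; push_cast; ring)

/-- **X11b with `ρ̄_{E,p}` onto, carrier `q ≠ p` (`q ∣ N_E`), `hs`-FREE** — as
`ClassX11b.bsdp_of_carrierMult_of_card_selmer_of_indexRecord` through `JET.JetchevDivisibilityCarrierNe`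
with the inflated index certificate `ord_p [E(K):ℤP] ≤ k + ord_p c_q(E)` at ONE `q ∣ N_E`, `q ≠ p`.
CONDITIONAL on `hJ` and the published binders; per pair; NOT a class theorem; nothing booked.
[cite: Jetchev2008, Thm. 1.4 and Cor. 1.5 (p. 812)] [cite: JetchevSkinnerWan2017, §7.4.1 (eq:gz for K′), pp. 29–30]
[cite: McCallumLMS1991, §5 Cor. 5.6 (p. 310)] [cite: Miller2011LMS, Def. 1.1] -/
theorem ClassX11b.bsdp_of_carrierNe_of_card_selmer_of_indexRecord
    (hJ : JET.JetchevDivisibilityCarrierNe)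
    (hMcU : McCallum1991_padicValNat_card_sha_primary_add_le_of_globalDivisibility)
    (hGZ : gross_zagier (W.conductorNorm ℤ) W K) (hKo : kolyvagin (W.conductorNorm ℤ) W K)
    (hGZK : rank_eq_analyticRank_of_analyticRank_le_one) (hmod : hasEntireLFunction_rat)
    (hShi : heegnerPointOfConductor_one_galoisConj (W.conductorNorm ℤ) W K)
    (hD36 : phi_heegnerTau_mem_singularModuliField (W.conductorNorm ℤ) W K)
    (hX : ClassX11b W p) (hsurj : W.HasSurjectiveModNGaloisRep p)
    (hK : IsImaginaryQuadratic K) (hdK : NumberField.discr K < -4)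
    (hHN : SatisfiesHeegnerHypothesis (W.conductorNorm ℤ) K)
    (hP : (P.map ι.toRatAlgHom) = heegnerPointComplex Dt H) (hc : ¬ (p : ℤ) ∣ Dt.c)
    (Wd : WeierstrassCurve ℚ) [Wd.IsElliptic] [Wd.IsGloballyMinimal] (Cd : VariableChange ℚ)
    (hWd : Cd • W.quadraticTwist (NumberField.discr K : ℚ) = Wd)
    (qd : ℚ) (hqd : Wd.entireLFunction 1 / (Wd.realPeriodRat : ℂ) = (qd : ℂ)) (hqd0 : qd ≠ 0)
    (q : ℕ) [Fact q.Prime] (hq : q ∣ W.conductorNorm ℤ) (hqp : q ≠ p) {k : ℕ}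
    (hI : padicValNat p (AddSubgroup.zmultiples P).index ≤
      k + padicValNat p ((W.baseChange ℚ_[q]).localTamagawaNumber ℤ_[q]))
    (hrec : 2 * (padicValNat p (AddSubgroup.zmultiples P).index : ℤ) =
      (2 * k : ℕ) + padicValRat p qd + padicValNat p W.tamagawaProduct)
    (hcard : Nat.card (W.selmerGroup (p : ℤ)) = p ^ (1 + 2 * k)) : BSDp W p := by
  obtain ⟨hr, hp2, hmult, hirr⟩ := hX
  have hμ : ¬ p ∣ Units.torsionOrder K := X2.not_dvd_unitsTorsionOrder_of_discr_lt hK hdK Fact.out hp2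
  have hu : padicValRat p (Cd.u : ℚ) = 0 :=
    padicValRat_u_eq_zero_of_twist_minimal W p K hK hHN hmult Cd hWd
  obtain ⟨s, hs, hv⟩ := exists_shaAn_padicValRat_eq_of_indexRecord W p (W.conductorNorm ℤ) K Dt H ι P
    hGZ hKo hGZK hmod hK hHN hP hp2 hc hμ hr hirr Wd Cd hWd hu qd hqd hqd0 (j := 2 * k) hrec
  have hnt : ¬ IsOfFinAddOrder P :=
    not_isOfFinAddOrder_heegner_of_rankOne_of_twist W (W.conductorNorm ℤ) K Dt H ι P hGZ hmod hK hHN hP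
      hr Wd Cd hWd qd hqd hqd0
  exact bsdp_of_carrierNe_of_card_selmer W p K hJ hMcU hGZK hKo hShi hD36 hK (by omega) (by omega) hHN
    hp2 hmult hsurj ⟨Dt, H, ι, hP⟩ hnt hr q hq hqp (k := k) hI hcard hs (by rw [hv]; push_cast; ring)

/-- **The (T2′) LB3 rows at `p = 3`, `hs`-free, carrier `q = 3`** (`IsX11Three W`, `ρ̄_{E,3}` onto):
index record `2·ord₃ [E(K):ℤP] = 2 + ord₃ q_d + ord₃ ∏c_ℓ(E)` at a Heegner field with `d_K < −4`,
`ord₃ [E(K):ℤP] ≤ 2`, `1 ≤ ord₃ c_3(E)`, EXACT `#Sel^(3)(E/ℚ) = 27` ⇒ `BSD(E,3)` — the (J∥)-currency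
twin of `IsX11Three.bsdp_of_millerJetchev_of_card_selmerThree_eq_of_indexRecord` (gen 21). EVIDENCE
pointer (nothing asserted): rows `191424ce1`, `463488bg1` (`4 = 2 + 1 + 1`). CONDITIONAL on `hJ` and
the facts; per pair; nothing booked; label unchanged. [cite: Jetchev2008, Thm. 1.4 and Cor. 1.5 (p. 812)]
[cite: JetchevSkinnerWan2017, §7.4.1 (eq:gz for K′), pp. 29–30] [cite: Miller2011LMS, Def. 1.1] -/
theorem IsX11Three.bsdp_of_carrierMult_of_card_selmerThree_eq_of_indexRecord
    (hJ : JET.JetchevDivisibilityCarrierMult)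
    (hMcU : McCallum1991_padicValNat_card_sha_primary_add_le_of_globalDivisibility)
    (hGZ : gross_zagier (W.conductorNorm ℤ) W K) (hKo : kolyvagin (W.conductorNorm ℤ) W K)
    (hGZK : rank_eq_analyticRank_of_analyticRank_le_one) (hmod : hasEntireLFunction_rat)
    (hShi : heegnerPointOfConductor_one_galoisConj (W.conductorNorm ℤ) W K)
    (hD36 : phi_heegnerTau_mem_singularModuliField (W.conductorNorm ℤ) W K)
    (hX : IsX11Three W) (hsurj : W.HasSurjectiveModNGaloisRep 3)
    (hK : IsImaginaryQuadratic K) (hdK : NumberField.discr K < -4)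
    (hHN : SatisfiesHeegnerHypothesis (W.conductorNorm ℤ) K)
    (hP : (P.map ι.toRatAlgHom) = heegnerPointComplex Dt H) (hc : ¬ (3 : ℤ) ∣ Dt.c)
    (Wd : WeierstrassCurve ℚ) [Wd.IsElliptic] [Wd.IsGloballyMinimal] (Cd : VariableChange ℚ)
    (hWd : Cd • W.quadraticTwist (NumberField.discr K : ℚ) = Wd)
    (qd : ℚ) (hqd : Wd.entireLFunction 1 / (Wd.realPeriodRat : ℂ) = (qd : ℂ)) (hqd0 : qd ≠ 0)
    (hcq : 1 ≤ padicValNat 3 ((W.baseChange ℚ_[3]).localTamagawaNumber ℤ_[3]))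
    (hI : padicValNat 3 (AddSubgroup.zmultiples P).index ≤ 2)
    (hrec : 2 * (padicValNat 3 (AddSubgroup.zmultiples P).index : ℤ) =
      2 + padicValRat 3 qd + padicValNat 3 W.tamagawaProduct)
    (hcard : Nat.card (W.selmerGroup (3 : ℤ)) = 27) : BSDp W 3 :=
  haveI : Fact (Nat.Prime 3) := ⟨by norm_num⟩
  ClassX11b.bsdp_of_carrierMult_of_card_selmer_of_indexRecord W 3 K Dt H ι P hJ hMcU hGZ hKo hGZK hmod
    hShi hD36 (classX11b_three_of_isX11Three W hX) hsurj hK hdK hHN hP (by exact_mod_cast hc) Wd Cd hWd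
    qd hqd hqd0 (k := 1) (by omega) (by rw [hrec]; push_cast; ring)
    (by rw [show ((3 : ℕ) : ℤ) = 3 by norm_num, hcard]; norm_num)

/-- **The (T2′) LB3 rows at `p = 3`, `hs`-free, carrier `q ≠ 3`** (`IsX11Three W`, `ρ̄_{E,3}` onto;
ONE `q ∣ N_E`, `q ≠ 3`, `1 ≤ ord₃ c_q(E)`), through `JET.JetchevDivisibilityCarrierNe`. EVIDENCE
pointer (nothing asserted): rows `318828a1` (`q = 2`), `368358k1` (`q = 29`), `498525ca1` (`q = 17`).
CONDITIONAL on `hJ` and the facts; per pair; nothing booked; label unchanged.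
[cite: Jetchev2008, Thm. 1.4 and Cor. 1.5 (p. 812)] [cite: JetchevSkinnerWan2017, §7.4.1 (eq:gz for K′), pp. 29–30]
[cite: Miller2011LMS, Def. 1.1] -/
theorem IsX11Three.bsdp_of_carrierNe_of_card_selmerThree_eq_of_indexRecord
    (hJ : JET.JetchevDivisibilityCarrierNe)
    (hMcU : McCallum1991_padicValNat_card_sha_primary_add_le_of_globalDivisibility)
    (hGZ : gross_zagier (W.conductorNorm ℤ) W K) (hKo : kolyvagin (W.conductorNorm ℤ) W K)
    (hGZK : rank_eq_analyticRank_of_analyticRank_le_one) (hmod : hasEntireLFunction_rat)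
    (hShi : heegnerPointOfConductor_one_galoisConj (W.conductorNorm ℤ) W K)
    (hD36 : phi_heegnerTau_mem_singularModuliField (W.conductorNorm ℤ) W K)
    (hX : IsX11Three W) (hsurj : W.HasSurjectiveModNGaloisRep 3)
    (hK : IsImaginaryQuadratic K) (hdK : NumberField.discr K < -4)
    (hHN : SatisfiesHeegnerHypothesis (W.conductorNorm ℤ) K)
    (hP : (P.map ι.toRatAlgHom) = heegnerPointComplex Dt H) (hc : ¬ (3 : ℤ) ∣ Dt.c)
    (Wd : WeierstrassCurve ℚ) [Wd.IsElliptic] [Wd.IsGloballyMinimal] (Cd : VariableChange ℚ)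
    (hWd : Cd • W.quadraticTwist (NumberField.discr K : ℚ) = Wd)
    (qd : ℚ) (hqd : Wd.entireLFunction 1 / (Wd.realPeriodRat : ℂ) = (qd : ℂ)) (hqd0 : qd ≠ 0)
    (q : ℕ) [Fact q.Prime] (hq : q ∣ W.conductorNorm ℤ) (hq3 : q ≠ 3)
    (hcq : 1 ≤ padicValNat 3 ((W.baseChange ℚ_[q]).localTamagawaNumber ℤ_[q]))
    (hI : padicValNat 3 (AddSubgroup.zmultiples P).index ≤ 2)
    (hrec : 2 * (padicValNat 3 (AddSubgroup.zmultiples P).index : ℤ) =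
      2 + padicValRat 3 qd + padicValNat 3 W.tamagawaProduct)
    (hcard : Nat.card (W.selmerGroup (3 : ℤ)) = 27) : BSDp W 3 :=
  haveI : Fact (Nat.Prime 3) := ⟨by norm_num⟩
  ClassX11b.bsdp_of_carrierNe_of_card_selmer_of_indexRecord W 3 K Dt H ι P hJ hMcU hGZ hKo hGZK hmod
    hShi hD36 (classX11b_three_of_isX11Three W hX) hsurj hK hdK hHN hP (by exact_mod_cast hc) Wd Cd hWd
    qd hqd hqd0 q hq hq3 (k := 1) (by omega) (by rw [hrec]; push_cast; ring)
    (by rw [show ((3 : ℕ) : ℤ) = 3 by norm_num, hcard]; norm_num)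

end Record

end Summit.BirchSwinnertonDyer.Rank1Residual.X11b

end
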